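/-
Copyright (c) 2026 the pub-hodgecm-mathlib formalisation cell (harness21).  Prover seat hodgecm-mathlib-K2Liu-p11 (g6), Track B «K2-LIT»,
#184♮ = hLiu418 = `stmt-HodgeConjecture-24832`; socket #41, KIND 1, package (K1b-♮), letter (dec-2-pay) F1 EDITION 2 «GENERAL K∞-TYPE» (LEAD F0P6-plan (g16) RULING
«M-160l», BATCH #287 (2)(b); LH4-p14 (g9) K-TYPE FINDING 2026-09-05T03:33Z): THE ASSEMBLER OF ★ p864699's `hBL₁` WITH THE MATRIX `K_σ`-TYPE ARCHIMEDEAN CLAUSE.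
THEOREMS ONLY (no `def`, no `instance`, no notation, no named-fact hypothesis, no `sorry`, default heartbeats).
-/
import Summits.HodgeConjecture.HodgeConjecture.Theorems.K2LiuKindOneLineBlockLetterOfRecord         -- ★ p865057 F1 ED. 1 (this seat): §1–§2 (`perPlace_repack`, `sum_mul_prod_le`, `exponent_window`, `frame_conj_mul`, …)
import Summits.HodgeConjecture.HodgeConjecture.Theorems.K2LiuKindOneLineCornerArchFactorKType      -- ★ (β-4) (LH4-p09 (g11)): `norm_corner_lineWhittaker_le_of_boundedMovers_kType` — the matrix-K-type twin of ★ p864675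
import HarnessLib

/-!
# Crux `HLiu418`, socket #41, KIND 1 — (dec-2-pay) F1 ED. 2 `K2LiuKindOneLineBlockLetterOfRecordKType`: ★ p864699's `hBL₁` FOR A GENERAL (MATRIX) `K_σ`-TYPE

Cell `hodgecm-mathlib`, crux item hLiu418 = `stmt-HodgeConjecture-24832` (helper lane `--supports … --as helper`, count-neutral); squad K2 ∕ K2Liu, socket #41, KIND 1,
package (K1b-♮).  ★ p865057 `blockLetter_rate_of_record` (ED. 1) takes the SCALAR `K_σ`-type clause `hsec.2` (= ★ p864675's `hK`) for every archimedean tensor factor; the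
tie's section family `f′` is an arbitrary STANDARD family (holomorphic + `K`-finite + flat), whose archimedean factors span finite-dimensional `K_σ`-stable spaces of
arbitrary type (LH4-p14 (g9) FINDING; LEAD RULING M-160l road (A)).  THIS EDITION keeps every byte of ED. 1's head — `hTU hLev {m} ι hι χσ hχ1 hχ {lam} hlam μf Finf Ffin`,
the LINE's EXPLICIT CHAIN `hchain₁` (F2, LH4-p14 (g9)) and the FINITE HALF `hFfin` (F3, K2Liu-p03 (g9)) and the conclusion (★ p864699 :182–:207 VERBATIM) — and REPLACES the
two scalar archimedean letters `hsec`, `hline` by ONE z-local letter **`harch`**: near every `z` (`0 < re z`) there are `r, C_L, d` such that for every `(i, σ, s)` on the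
ball the factor `Finf i σ s` is a COORDINATE `j₀` of a tuple `F⃗ : Fin d → (tube matrices → ℂ)` of archimedean Siegel sections of `I_σ(s, χσ σ)` with a MATRIX `K_σ`-type
(`F⃗ a (g·k) = Σ_b τ_{ab} F⃗ b (g)`, `‖τ_{ab}‖ ≤ 1`, for `k ∈ U(J) ∩ Stab(iI)`), one rank-one line letter per component with the common constant `C_L`, and integrable line
integrands — exactly the hypotheses of the (β-K) archimedean factor ★ `norm_corner_lineWhittaker_le_of_boundedMovers_kType` (LH4-p09 (g11)), which replaces ★ p864675 in the per-place step (constant `d·C_L`).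
* **`blockLetter_rate_of_record_ktype`** — ED. 1's assembly with `C := m·Cf·(d·C_L(64M²)^{κ₁+1}(32M²)^{κ₂}max(1,λ))^{#Sinf}` (LEAD: «`N(τ)` only in `C`»), same
  `a := af`, `a₂`, `N₀`, `κ₁ κ₂`, `Ng := 1`, `r`, `cπ := λπ∕(64M²)`, `e₁ e₂`.
HONEST LABEL.  Count-neutral helper, hypothesis-first in `hTU hLev harch hchain₁ hFfin`; closes no socket: `HC_CM` is proved only modulo the 7 printed citations (2 remaining
named inputs: hLiu418 = `stmt-HodgeConjecture-24832`, h413 = `stmt-HodgeConjecture-24833`) until rung 0 closes.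

## References
* [KudlaRallis1994] S. Kudla, S. Rallis, Ann. of Math. 140 (1994): §2 (2.10)–(2.12).
* [MoeglinWaldspurger1995] C. Mœglin, J.-L. Waldspurger, *Spectral decomposition and Eisenstein series* (1995): I.2.2, II.1.7, IV.1.9.
* [Shimura1997] G. Shimura, CBMS 93 (1997): §16, §18.4 Prop. 18.14.   * [BorelJacquet1979] A. Borel, H. Jacquet, PSPM 33.1 (1979): §1.2, §4.1.
-/

set_option autoImplicit false
set_option linter.dupNamespace false -- the mandated namespace repeats `HodgeConjecture.HodgeConjecture`

noncomputable section

open scoped Matrix ENNReal NNReal ComplexConjugate BigOperators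
open scoped Classical
open NumberField NumberField.InfinitePlace IsDedekindDomain MeasureTheory MeasureTheory.Measure Complex
open Literature.NumberTheory.Automorphic Literature.NumberTheory.Automorphic.UnitaryGroup Literature.NumberTheory.GaloisRepresentations
open Literature.NumberTheory.GelbartRogawski1991 Literature.NumberTheory.GelbartRogawski1991.GRConstruction
open Literature.NumberTheory.GelbartRogawski1991.AdaptedBlocks
open Literature.NumberTheory.K2Lit.SiegelDoubled Literature.MeasureTheory.Group
open Literature.NumberTheory.ModularForms.SiegelUpperHalfSpace (moeb)
open UnitaryDualPair

namespace Summit.HodgeConjecture.HodgeConjecture.Cruxes.HLiu418.K2LiuKindOneLineBlockLetterOfRecordKType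

open K2LiuSiegelUnipotentFourierDefs K2LiuSiegelUnipotentCharacters K2LiuUnipotentCoveringWeight K2LiuSiegelFourierCoeffDelta
open K2LiuSiegelRationalLeviDecomposition K2LiuSiegelMiddleCellSortedPattern K2LiuSiegelMiddleCellLeviCriterion K2LiuSiegelBruhatMiddleCellDelta
open K2LiuArchInducedTubeDefs (IsArchSiegelSection)
open K2LiuKindOneLineBlockLetterOfRecord (perPlace_repack sum_mul_prod_le exponent_window frame_conj_mul fromBlocks_diag_mul_blockUpper_mul)
open K2LiuKindOneLineCornerArchFactorKType (norm_corner_lineWhittaker_le_of_boundedMovers_kType)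

/-- **(dec-2-pay) F1 ED. 2 — ★ p864699's `hBL₁` FOR A GENERAL MATRIX `K_σ`-TYPE.**  As ★ `blockLetter_rate_of_record` (ED. 1) with the scalar archimedean letters
`hsec hline` replaced by the z-local tuple letter `harch` (module docstring); the archimedean factor discharged per `σ` by the (β-K) head ★ `norm_corner_lineWhittaker_le_of_boundedMovers_kType` at the
coordinate `j₀` of the tuple (`Y := σ(γ̂)·A_σ`, movers `κ_σ κ′_σ`, `μ := μf σ σf`), repacked by ★ `perPlace_repack` with `C_L := d·C_L`.
[cite: KudlaRallis1994, §2 (2.10)–(2.12)] [cite: MoeglinWaldspurger1995, II.1.7, IV.1.9] [cite: Shimura1997, §16, §18.4 Prop. 18.14] [cite: BorelJacquet1979, §1.2, §4.1] -/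
theorem blockLetter_rate_of_record_ktype
    (L : Type) [Field L] [NumberField L] [IsCMField L] (e : Fin 2 × Fin 1 ≃ Fin 2)
    (dV : Fin 2 → L) (hdV : ∀ i, IsCMField.complexConj L (dV i) = dV i)
    (dW : Fin 1 → L) (hdW : ∀ i, IsCMField.complexConj L (dW i) = dW i)
    (f : ℂ → HA L e dV hdV dW hdW → ℂ)
    {n₁₀ n₂₀ : ℕ} (eA₀ : Fin 1 × Fin 1 ≃ Fin n₁₀) (eB₀ : Fin 1 × Fin 1 ≃ Fin n₂₀)
    (dA₀ : Fin 1 → L) (hdA₀ : ∀ i, IsCMField.complexConj L (dA₀ i) = dA₀ i)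
    (dB₀ : Fin 1 → L) (hdB₀ : ∀ i, IsCMField.complexConj L (dB₀ i) = dB₀ i)
    (hVA₀ : ∀ i, dV (Fin.castAdd 1 i) = dA₀ i) (hVB₀ : ∀ j, dV (Fin.natAdd 1 j) = dB₀ j)
    [MeasurableSpace (unipDelta L eB₀ dB₀ hdB₀ dW hdW)]
    (Λ₀ : GL (Fin 2) (AdeleRing (𝓞 L) L) →* HA L e dV hdV dW hdW)
    [MeasurableSpace (AdeleRing (𝓞 (Fp L)) (Fp L))]
    (μ₀ : Measure (AdeleRing (𝓞 (Fp L)) (Fp L)))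
    (nB₀ : AdeleRing (𝓞 (Fp L)) (Fp L) → unipDelta L eB₀ dB₀ hdB₀ dW hdW)
    (γ₀ : Projectivization L (Fin 2 → L) → GL (Fin 2) L)
    (hc : (IsCMField.complexConj L : L ≃ₐ[Fp L] L) ≠ 1)
    {Sinf : Type} [Fintype Sinf] (wp : Sinf → {v : InfinitePlace L // IsComplex v})
    (hwp : ∀ σ, (IsCMField.complexConj L : L ≃ₐ[Fp L] L) • (wp σ).1 = (wp σ).1)
    (er : Fin 2 ⊕ Fin 2 ≃ Fin (2 + 2)) (T Tinv : Sinf → Matrix (Fin 2 ⊕ Fin 2) (Fin 2 ⊕ Fin 2) ℂ) (hT' : ∀ σ, Tinv σ * T σ = 1)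
    {M : ℝ} (hM : 1 ≤ M)
    -- THE FRAME LETTERS: `U(J)`-valued frames and the LEVI LETTER (★ `K2LiuKindOneLineLeviFrameDictionary` §3∕§4 at the adapted frames)
    (hTU : ∀ (σ : Sinf) (g : GL (Fin (2 + 2)) ℂ), g ∈ archLocal L (2 + 2) (hermD L e dV hdV dW hdW) (wp σ) →
      (T σ * Matrix.reindex er.symm er.symm (g : Matrix (Fin (2 + 2)) (Fin (2 + 2)) ℂ) * Tinv σ)ᴴ * Matrix.J (Fin 2) ℂ *
        (T σ * Matrix.reindex er.symm er.symm (g : Matrix (Fin (2 + 2)) (Fin (2 + 2)) ℂ) * Tinv σ) = Matrix.J (Fin 2) ℂ)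
    (hLev : ∀ (σ : Sinf) (γ : GL (Fin 2) L), ∃ G' : Matrix (Fin 2) (Fin 2) ℂ, T σ * Matrix.reindex er.symm er.symm
            ((((archAt (Fp L) L (IsCMField.complexConj L : L ≃ₐ[Fp L] L) (2 + 2) (hermD L e dV hdV dW hdW) (wp σ) (hwp σ) hc
                (archPart (Fp L) L (IsCMField.complexConj L : L ≃ₐ[Fp L] L) (2 + 2) (hermD L e dV hdV dW hdW) (Λ₀ (Matrix.GeneralLinearGroup.map (algebraMap L (AdeleRing (𝓞 L) L)) γ))) :
                archLocal L (2 + 2) (hermD L e dV hdV dW hdW) (wp σ)) : GL (Fin (2 + 2)) ℂ) : Matrix (Fin (2 + 2)) (Fin (2 + 2)) ℂ)) * Tinv σ =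
      Matrix.fromBlocks ((γ : Matrix (Fin 2) (Fin 2) L).map (wp σ).1.embedding) 0 0 G')
    -- a tensor presentation's archimedean letters, the LINE's EXPLICIT CHAIN, and the FINITE HALF — BY VALUE
    {m : ℕ} (ι : Matrix (Fin 1 ⊕ Fin 1) (Fin 1 ⊕ Fin 1) ℂ → Matrix (Fin 2 ⊕ Fin 2) (Fin 2 ⊕ Fin 2) ℂ)
    (hι : ∀ x, ι x = Matrix.fromBlocks !![1, 0; 0, x (Sum.inl 0) (Sum.inl 0)] !![0, 0; 0, x (Sum.inl 0) (Sum.inr 0)]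
      !![0, 0; 0, x (Sum.inr 0) (Sum.inl 0)] !![1, 0; 0, x (Sum.inr 0) (Sum.inr 0)])
    (χσ : Sinf → ℂ → ℂ) (hχ1 : ∀ σ, χσ σ 1 = 1) (hχ : ∀ (σ : Sinf) (z : ℂ), z ≠ 0 → ‖χσ σ z‖ ≤ 1)
    {lam : ℝ} (hlam : 0 < lam) (μf : Sinf → L → ℝ)
    (Finf : Fin m → Sinf → ℂ → Matrix (Fin 2 ⊕ Fin 2) (Fin 2 ⊕ Fin 2) ℂ → ℂ) (Ffin : Fin m → L → HA L e dV hdV dW hdW → ℂ → ℂ)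
    (harch : ∀ z : ℂ, 0 < z.re → ∃ (r CL : ℝ) (d : ℕ), 0 < r ∧ 0 ≤ CL ∧ ∀ (i : Fin m) (σ : Sinf) (s : ℂ), dist s z < r →
      ∃ (Fv : Fin d → Matrix (Fin 2 ⊕ Fin 2) (Fin 2 ⊕ Fin 2) ℂ → ℂ) (j₀ : Fin d), Fv j₀ = Finf i σ s ∧ (∀ j, IsArchSiegelSection (χσ σ) s (Fv j)) ∧
        (∀ k : Matrix (Fin 2 ⊕ Fin 2) (Fin 2 ⊕ Fin 2) ℂ, kᴴ * Matrix.J (Fin 2) ℂ * k = Matrix.J (Fin 2) ℂ → moeb k (I • (1 : Matrix (Fin 2) (Fin 2) ℂ)) = I • 1 →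
          ∃ τ : Matrix (Fin d) (Fin d) ℂ, (∀ a b, ‖τ a b‖ ≤ 1) ∧ ∀ (g : Matrix (Fin 2 ⊕ Fin 2) (Fin 2 ⊕ Fin 2) ℂ) (a : Fin d), Fv a (g * k) = ∑ b, τ a b * Fv b g) ∧
        (∀ (j : Fin d) (hh : ℝ), ‖∫ t : ℝ, Fv j (ι (Matrix.J (Fin 1) ℂ * Matrix.fromBlocks 1 ((t : ℂ) • (1 : Matrix (Fin 1) (Fin 1) ℂ)) 0 1)) * Complex.exp (-(2 * Real.pi * I * hh * t))‖ ≤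
          CL * (1 + |hh|) * Real.exp (-(Real.pi * |hh|))) ∧
        (∀ (j : Fin d) (x : Matrix (Fin 1 ⊕ Fin 1) (Fin 1 ⊕ Fin 1) ℂ), MeasureTheory.Integrable (fun t : ℝ =>
          Fv j (ι (Matrix.J (Fin 1) ℂ * Matrix.fromBlocks 1 ((t : ℂ) • (1 : Matrix (Fin 1) (Fin 1) ℂ)) 0 1 * x)))))
    (hchain₁ :
            ∀ (S : skewMatrices ((IsCMField.complexConj L : L ≃ₐ[Fp L] L) : L →+* L) ((gramR L e dV hdV dW hdW).map (algebraMap (Fp L) L))) (u w : Fin 2 → L),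
        (S : Matrix (Fin 2) (Fin 2) L) = Matrix.vecMulVec u w → u ≠ 0 → ∀ (hw : w ≠ 0) (S' : Matrix (Fin 2) (Fin 2) L),
        (∀ v : HA L e dV hdV dW hdW, v ∈ unipDelta L e dV hdV dW hdW →
          unipDeltaChar L e dV hdV dW hdW (S : Matrix (Fin 2) (Fin 2) L) ((Λ₀ (Matrix.GeneralLinearGroup.map (algebraMap L (AdeleRing (𝓞 L) L)) (γ₀ (Projectivization.mk L w hw))))⁻¹ * v * Λ₀ (Matrix.GeneralLinearGroup.map (algebraMap L (AdeleRing (𝓞 L) L)) (γ₀ (Projectivization.mk L w hw)))) =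
            unipDeltaChar L e dV hdV dW hdW S' v) →
        ∀ D : ℕ, 1 ≤ D → (∀ i j, IsIntegral ℤ ((D : L) * (S : Matrix (Fin 2) (Fin 2) L) i j)) →
        ∀ (D₀ : Matrix (Fin 2) (Fin 2) L) (σf : L),
        (((γ₀ (Projectivization.mk L w hw) : GL (Fin 2) L) : Matrix (Fin 2) (Fin 2) L).map ((IsCMField.complexConj L : L ≃ₐ[Fp L] L) : L →+* L))ᵀ * (gramR L e dV hdV dW hdW).map (algebraMap (Fp L) L) * D₀ =
            (gramR L e dV hdV dW hdW).map (algebraMap (Fp L) L) →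
        D₀ * (S : Matrix (Fin 2) (Fin 2) L) * ((γ₀ (Projectivization.mk L w hw) : GL (Fin 2) L) : Matrix (Fin 2) (Fin 2) L)⁻¹ = Matrix.single 1 1 σf →
        ∀ s : ℂ, 0 < s.re → ∀ (h : HA L e dV hdV dW hdW),
        (∀ σ : Sinf, |μf σ σf| = lam * (wp σ).1 σf) ∧
                ‖whittakerDelta L eB₀ dB₀ hdB₀ dW hdW (Measure.map nB₀ μ₀)
            ((Matrix.reindex (idxSplit e eA₀ eB₀) (idxSplit e eA₀ eB₀) S').toBlocks₂₂)
            (fun y => f s (blkD L e eA₀ eB₀ dA₀ hdA₀ dB₀ hdB₀ dV hdV hVA₀ hVB₀ dW hdW (1, y) * (Λ₀ (Matrix.GeneralLinearGroup.map (algebraMap L (AdeleRing (𝓞 L) L)) (γ₀ (Projectivization.mk L w hw))) * h))) 1‖ ≤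
          ∑ i : Fin m, ‖Ffin i σf (Λ₀ (Matrix.GeneralLinearGroup.map (algebraMap L (AdeleRing (𝓞 L) L)) (γ₀ (Projectivization.mk L w hw))) * h) s‖ *
            ∏ σ : Sinf, ‖∫ t : ℝ, Finf i σ s (ι (Matrix.J (Fin 1) ℂ * Matrix.fromBlocks 1 ((t : ℂ) • (1 : Matrix (Fin 1) (Fin 1) ℂ)) 0 1) *
          (T σ * Matrix.reindex er.symm er.symm
            ((((archAt (Fp L) L (IsCMField.complexConj L : L ≃ₐ[Fp L] L) (2 + 2) (hermD L e dV hdV dW hdW) (wp σ) (hwp σ) hc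
                (archPart (Fp L) L (IsCMField.complexConj L : L ≃ₐ[Fp L] L) (2 + 2) (hermD L e dV hdV dW hdW) (Λ₀ (Matrix.GeneralLinearGroup.map (algebraMap L (AdeleRing (𝓞 L) L)) (γ₀ (Projectivization.mk L w hw))) * h)) :
                archLocal L (2 + 2) (hermD L e dV hdV dW hdW) (wp σ)) : GL (Fin (2 + 2)) ℂ) : Matrix (Fin (2 + 2)) (Fin (2 + 2)) ℂ)) * Tinv σ)) *
            Complex.exp (-(2 * Real.pi * I * μf σ σf * t))‖)
    (hFfin : ∀ z : ℂ, 0 < z.re → ∃ (r Cf af a₂ : ℝ) (N₀ : ℕ), 0 < r ∧ 0 ≤ Cf ∧ 0 ≤ af ∧ 0 ≤ a₂ ∧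
            ∀ (S : skewMatrices ((IsCMField.complexConj L : L ≃ₐ[Fp L] L) : L →+* L) ((gramR L e dV hdV dW hdW).map (algebraMap (Fp L) L))) (u w : Fin 2 → L),
        (S : Matrix (Fin 2) (Fin 2) L) = Matrix.vecMulVec u w → u ≠ 0 → ∀ (hw : w ≠ 0) (S' : Matrix (Fin 2) (Fin 2) L),
        (∀ v : HA L e dV hdV dW hdW, v ∈ unipDelta L e dV hdV dW hdW →
          unipDeltaChar L e dV hdV dW hdW (S : Matrix (Fin 2) (Fin 2) L) ((Λ₀ (Matrix.GeneralLinearGroup.map (algebraMap L (AdeleRing (𝓞 L) L)) (γ₀ (Projectivization.mk L w hw))))⁻¹ * v * Λ₀ (Matrix.GeneralLinearGroup.map (algebraMap L (AdeleRing (𝓞 L) L)) (γ₀ (Projectivization.mk L w hw)))) =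
            unipDeltaChar L e dV hdV dW hdW S' v) →
        ∀ D : ℕ, 1 ≤ D → (∀ i j, IsIntegral ℤ ((D : L) * (S : Matrix (Fin 2) (Fin 2) L) i j)) →
        ∀ (D₀ : Matrix (Fin 2) (Fin 2) L) (σf : L),
        (((γ₀ (Projectivization.mk L w hw) : GL (Fin 2) L) : Matrix (Fin 2) (Fin 2) L).map ((IsCMField.complexConj L : L ≃ₐ[Fp L] L) : L →+* L))ᵀ * (gramR L e dV hdV dW hdW).map (algebraMap (Fp L) L) * D₀ =
            (gramR L e dV hdV dW hdW).map (algebraMap (Fp L) L) →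
        D₀ * (S : Matrix (Fin 2) (Fin 2) L) * ((γ₀ (Projectivization.mk L w hw) : GL (Fin 2) L) : Matrix (Fin 2) (Fin 2) L)⁻¹ = Matrix.single 1 1 σf →
        ∀ s : ℂ, dist s z < r → ∀ (h : HA L e dV hdV dW hdW) (i : Fin m),
        ‖Ffin i σf (Λ₀ (Matrix.GeneralLinearGroup.map (algebraMap L (AdeleRing (𝓞 L) L)) (γ₀ (Projectivization.mk L w hw))) * h) s‖ ≤
          Cf * adelicHeightGL (2 + 2) L (h : GL (Fin (2 + 2)) (AdeleRing (𝓞 L) L)) ^ af * (D : ℝ) ^ a₂ *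
            (1 + ‖(fun i j => NumberField.mixedEmbedding L ((S : Matrix (Fin 2) (Fin 2) L) i j))‖) ^ N₀) :
    ∀ z : ℂ, 0 < z.re → ∃ (C a a₂ κ₁ κ₂ Ng r cπ : ℝ) (N₀ : ℕ) (e₁ e₂ : ℂ → ℝ),
      0 ≤ C ∧ 0 ≤ a ∧ 0 ≤ a₂ ∧ 0 ≤ Ng ∧ 0 < r ∧ 0 < cπ ∧ (∀ s : ℂ, dist s z < r → |e₁ s| ≤ κ₁ ∧ |e₂ s| ≤ κ₂) ∧
      ∀ (S : skewMatrices ((IsCMField.complexConj L : L ≃ₐ[Fp L] L) : L →+* L) ((gramR L e dV hdV dW hdW).map (algebraMap (Fp L) L))) (u w : Fin 2 → L),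
        (S : Matrix (Fin 2) (Fin 2) L) = Matrix.vecMulVec u w → u ≠ 0 → ∀ (hw : w ≠ 0) (S' : Matrix (Fin 2) (Fin 2) L),
        (∀ v : HA L e dV hdV dW hdW, v ∈ unipDelta L e dV hdV dW hdW →
          unipDeltaChar L e dV hdV dW hdW (S : Matrix (Fin 2) (Fin 2) L) ((Λ₀ (Matrix.GeneralLinearGroup.map (algebraMap L (AdeleRing (𝓞 L) L)) (γ₀ (Projectivization.mk L w hw))))⁻¹ * v * Λ₀ (Matrix.GeneralLinearGroup.map (algebraMap L (AdeleRing (𝓞 L) L)) (γ₀ (Projectivization.mk L w hw)))) =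
            unipDeltaChar L e dV hdV dW hdW S' v) →
        ∀ D : ℕ, 1 ≤ D → (∀ i j, IsIntegral ℤ ((D : L) * (S : Matrix (Fin 2) (Fin 2) L) i j)) →
        ∀ (D₀ : Matrix (Fin 2) (Fin 2) L) (σf : L),
        (((γ₀ (Projectivization.mk L w hw) : GL (Fin 2) L) : Matrix (Fin 2) (Fin 2) L).map ((IsCMField.complexConj L : L ≃ₐ[Fp L] L) : L →+* L))ᵀ * (gramR L e dV hdV dW hdW).map (algebraMap (Fp L) L) * D₀ =
            (gramR L e dV hdV dW hdW).map (algebraMap (Fp L) L) →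
        D₀ * (S : Matrix (Fin 2) (Fin 2) L) * ((γ₀ (Projectivization.mk L w hw) : GL (Fin 2) L) : Matrix (Fin 2) (Fin 2) L)⁻¹ = Matrix.single 1 1 σf →
        ∀ s : ℂ, dist s z < r → ∀ (h : HA L e dV hdV dW hdW) (A b d : Sinf → Matrix (Fin 2) (Fin 2) ℂ) (κ κ' : Sinf → Matrix (Fin 2 ⊕ Fin 2) (Fin 2 ⊕ Fin 2) ℂ),
        (∀ σ, κ σ * κ' σ = 1) → (∀ σ, κ' σ * κ σ = 1) → (∀ σ i j, ‖κ σ i j‖ ≤ M) → (∀ σ i j, ‖κ' σ i j‖ ≤ M) →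
        (∀ σ, T σ * Matrix.reindex er.symm er.symm
            ((((archAt (Fp L) L (IsCMField.complexConj L : L ≃ₐ[Fp L] L) (2 + 2) (hermD L e dV hdV dW hdW) (wp σ) (hwp σ) hc
                (archPart (Fp L) L (IsCMField.complexConj L : L ≃ₐ[Fp L] L) (2 + 2) (hermD L e dV hdV dW hdW) h) :
                archLocal L (2 + 2) (hermD L e dV hdV dW hdW) (wp σ)) : GL (Fin (2 + 2)) ℂ) : Matrix (Fin (2 + 2)) (Fin (2 + 2)) ℂ)) * Tinv σ =
          Matrix.fromBlocks (A σ) (b σ) 0 (d σ) * κ σ) →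
        ‖whittakerDelta L eB₀ dB₀ hdB₀ dW hdW (Measure.map nB₀ μ₀)
            ((Matrix.reindex (idxSplit e eA₀ eB₀) (idxSplit e eA₀ eB₀) S').toBlocks₂₂)
            (fun y => f s (blkD L e eA₀ eB₀ dA₀ hdA₀ dB₀ hdB₀ dV hdV hVA₀ hVB₀ dW hdW (1, y) * (Λ₀ (Matrix.GeneralLinearGroup.map (algebraMap L (AdeleRing (𝓞 L) L)) (γ₀ (Projectivization.mk L w hw))) * h))) 1‖ ≤
          C * adelicHeightGL (2 + 2) L (h : GL (Fin (2 + 2)) (AdeleRing (𝓞 L) L)) ^ a * (D : ℝ) ^ a₂ *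
            (1 + ‖(fun i j => NumberField.mixedEmbedding L ((S : Matrix (Fin 2) (Fin 2) L) i j))‖) ^ N₀ *
            ∏ σ, ((∑ k, ‖(((γ₀ (Projectivization.mk L w hw) : GL (Fin 2) L) : Matrix (Fin 2) (Fin 2) L).map (wp σ).1.embedding * A σ) 1 k‖ ^ 2) ^ e₁ s * ‖(((γ₀ (Projectivization.mk L w hw) : GL (Fin 2) L) : Matrix (Fin 2) (Fin 2) L).map (wp σ).1.embedding * A σ).det‖ ^ e₂ s *
              ((1 + (wp σ).1 σf * (∑ k, ‖(((γ₀ (Projectivization.mk L w hw) : GL (Fin 2) L) : Matrix (Fin 2) (Fin 2) L).map (wp σ).1.embedding * A σ) 1 k‖ ^ 2)) ^ Ng * Real.exp (-(cπ * ((wp σ).1 σf * (∑ k, ‖(((γ₀ (Projectivization.mk L w hw) : GL (Fin 2) L) : Matrix (Fin 2) (Fin 2) L).map (wp σ).1.embedding * A σ) 1 k‖ ^ 2)))))) := by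
  intro z hz
  obtain ⟨r₁, CL, dK, hr₁, hCL, harc⟩ := harch z hz
  have hdCL : 0 ≤ (dK : ℝ) * CL := mul_nonneg (Nat.cast_nonneg _) hCL
  obtain ⟨r₂, Cf, af, a₂, N₀, hr₂, hCf, haf, ha₂, hfin⟩ := hFfin z hz
  have hM0 : 0 ≤ M := zero_le_one.trans hM
  have hM2 : 1 ≤ M ^ 2 := by nlinarith
  have hB₁ : (1 : ℝ) ≤ 64 * M ^ 2 := by nlinarith
  have hB₂ : (1 : ℝ) ≤ 32 * M ^ 2 := by nlinarith
  have hr : 0 < min (min r₁ r₂) z.re := lt_min (lt_min hr₁ hr₂) hz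
  have hKσ0 : 0 ≤ (dK : ℝ) * CL * (64 * M ^ 2) ^ (|2 * z.re + 1| + 2 * min (min r₁ r₂) z.re + 1) * (32 * M ^ 2) ^ (|2 * z.re + 2| + 2 * min (min r₁ r₂) z.re) * max 1 lam :=
    mul_nonneg (mul_nonneg (mul_nonneg hdCL (Real.rpow_nonneg (by positivity) _)) (Real.rpow_nonneg (by positivity) _)) (le_trans zero_le_one (le_max_left _ _))
  refine ⟨(m : ℝ) * Cf * ((dK : ℝ) * CL * (64 * M ^ 2) ^ (|2 * z.re + 1| + 2 * min (min r₁ r₂) z.re + 1) * (32 * M ^ 2) ^ (|2 * z.re + 2| + 2 * min (min r₁ r₂) z.re) *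
      max 1 lam) ^ Fintype.card Sinf,
    af, a₂, |2 * z.re + 1| + 2 * min (min r₁ r₂) z.re, |2 * z.re + 2| + 2 * min (min r₁ r₂) z.re, 1, min (min r₁ r₂) z.re,
    Real.pi / (64 * M ^ 2) * lam, N₀, fun s => -(2 * s.re + 1), fun s => 2 * s.re + 2,
    mul_nonneg (mul_nonneg (Nat.cast_nonneg _) hCf) (pow_nonneg hKσ0 _), haf, ha₂, zero_le_one, hr, by positivity, fun s hs => ?_, ?_⟩
  · beta_reduce
    obtain ⟨h1, h2, -⟩ := exponent_window hs
    exact ⟨by rwa [abs_neg], h2⟩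
  intro S u w hS hu hw S' hψ D hD hint D₀ σf hrel hcorner s hs h A b d κ κ' hκκ' hκ'κ hκe hκ'e hdec
  obtain ⟨hκ₁, hκ₂, hsre⟩ := exponent_window hs
  have hs₀ : 0 < s.re := by
    have : min (min r₁ r₂) z.re ≤ z.re := min_le_right _ _
    linarith
  have hs₁ : dist s z < r₁ := lt_of_lt_of_le hs ((min_le_left _ _).trans (min_le_left _ _))
  have hs₂ : dist s z < r₂ := lt_of_lt_of_le hs ((min_le_left _ _).trans (min_le_right _ _))
  obtain ⟨hμ, hch⟩ := hchain₁ S u w hS hu hw S' hψ D hD hint D₀ σf hrel hcorner s hs₀ h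
  choose Gc hGc using hLev
  -- THE POINT IN THE FRAME: Levi letter × Iwasawa blocks of `h`
  have hP : ∀ σ : Sinf, T σ * Matrix.reindex er.symm er.symm
        ((((archAt (Fp L) L (IsCMField.complexConj L : L ≃ₐ[Fp L] L) (2 + 2) (hermD L e dV hdV dW hdW) (wp σ) (hwp σ) hc
            (archPart (Fp L) L (IsCMField.complexConj L : L ≃ₐ[Fp L] L) (2 + 2) (hermD L e dV hdV dW hdW)
              (Λ₀ (Matrix.GeneralLinearGroup.map (algebraMap L (AdeleRing (𝓞 L) L)) (γ₀ (Projectivization.mk L w hw))) * h)) :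
            archLocal L (2 + 2) (hermD L e dV hdV dW hdW) (wp σ)) : GL (Fin (2 + 2)) ℂ) : Matrix (Fin (2 + 2)) (Fin (2 + 2)) ℂ)) * Tinv σ =
      Matrix.fromBlocks ((((γ₀ (Projectivization.mk L w hw) : GL (Fin 2) L) : Matrix (Fin 2) (Fin 2) L).map (wp σ).1.embedding) * A σ) ((((γ₀ (Projectivization.mk L w hw) : GL (Fin 2) L) : Matrix (Fin 2) (Fin 2) L).map (wp σ).1.embedding) * b σ) 0 (Gc σ (γ₀ (Projectivization.mk L w hw)) * d σ) * κ σ := fun σ => by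
    rw [frame_conj_mul L e dV hdV dW hdW hc wp hwp er T Tinv hT' _ _ σ, hGc σ, hdec σ, fromBlocks_diag_mul_blockUpper_mul]
  -- the point is `J`-unitary (the frames carry `U(H_σ)` into `U(J)`)
  have hPU : ∀ σ : Sinf, (Matrix.fromBlocks ((((γ₀ (Projectivization.mk L w hw) : GL (Fin 2) L) : Matrix (Fin 2) (Fin 2) L).map (wp σ).1.embedding) * A σ) ((((γ₀ (Projectivization.mk L w hw) : GL (Fin 2) L) : Matrix (Fin 2) (Fin 2) L).map (wp σ).1.embedding) * b σ) 0 (Gc σ (γ₀ (Projectivization.mk L w hw)) * d σ) * κ σ)ᴴ * Matrix.J (Fin 2) ℂ *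
      (Matrix.fromBlocks ((((γ₀ (Projectivization.mk L w hw) : GL (Fin 2) L) : Matrix (Fin 2) (Fin 2) L).map (wp σ).1.embedding) * A σ) ((((γ₀ (Projectivization.mk L w hw) : GL (Fin 2) L) : Matrix (Fin 2) (Fin 2) L).map (wp σ).1.embedding) * b σ) 0 (Gc σ (γ₀ (Projectivization.mk L w hw)) * d σ) * κ σ) = Matrix.J (Fin 2) ℂ := fun σ => by
    rw [← hP σ]
    exact hTU σ _ (archAt (Fp L) L (IsCMField.complexConj L : L ≃ₐ[Fp L] L) (2 + 2) (hermD L e dV hdV dW hdW) (wp σ) (hwp σ) hc _).2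
  -- the finite half
  have hF := hfin S u w hS hu hw S' hψ D hD hint D₀ σf hrel hcorner s hs₂ h
  -- ASSEMBLY: Σ_i (finite) · ∏_σ (archimedean by ★ p864675, repacked)
  refine hch.trans ?_
  refine (sum_mul_prod_le (fun i : Fin m => ‖Ffin i σf (Λ₀ (Matrix.GeneralLinearGroup.map (algebraMap L (AdeleRing (𝓞 L) L)) (γ₀ (Projectivization.mk L w hw))) * h) s‖)
    (fun (i : Fin m) (σ : Sinf) => ‖∫ t : ℝ, Finf i σ s (ι (Matrix.J (Fin 1) ℂ * Matrix.fromBlocks 1 ((t : ℂ) • (1 : Matrix (Fin 1) (Fin 1) ℂ)) 0 1) *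
          (T σ * Matrix.reindex er.symm er.symm
            ((((archAt (Fp L) L (IsCMField.complexConj L : L ≃ₐ[Fp L] L) (2 + 2) (hermD L e dV hdV dW hdW) (wp σ) (hwp σ) hc
                (archPart (Fp L) L (IsCMField.complexConj L : L ≃ₐ[Fp L] L) (2 + 2) (hermD L e dV hdV dW hdW) (Λ₀ (Matrix.GeneralLinearGroup.map (algebraMap L (AdeleRing (𝓞 L) L)) (γ₀ (Projectivization.mk L w hw))) * h)) :
                archLocal L (2 + 2) (hermD L e dV hdV dW hdW) (wp σ)) : GL (Fin (2 + 2)) ℂ) : Matrix (Fin (2 + 2)) (Fin (2 + 2)) ℂ)) * Tinv σ)) *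
            Complex.exp (-(2 * Real.pi * I * μf σ σf * t))‖)
    (fun σ : Sinf => (∑ k, ‖((((γ₀ (Projectivization.mk L w hw) : GL (Fin 2) L) : Matrix (Fin 2) (Fin 2) L).map (wp σ).1.embedding) * A σ) 1 k‖ ^ 2) ^ (-(2 * s.re + 1)) * ‖((((γ₀ (Projectivization.mk L w hw) : GL (Fin 2) L) : Matrix (Fin 2) (Fin 2) L).map (wp σ).1.embedding) * A σ).det‖ ^ (2 * s.re + 2) *
      ((1 + (wp σ).1 σf * (∑ k, ‖((((γ₀ (Projectivization.mk L w hw) : GL (Fin 2) L) : Matrix (Fin 2) (Fin 2) L).map (wp σ).1.embedding) * A σ) 1 k‖ ^ 2)) ^ (1 : ℝ) * Real.exp (-(Real.pi / (64 * M ^ 2) * lam * ((wp σ).1 σf * (∑ k, ‖((((γ₀ (Projectivization.mk L w hw) : GL (Fin 2) L) : Matrix (Fin 2) (Fin 2) L).map (wp σ).1.embedding) * A σ) 1 k‖ ^ 2))))))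
    (K := (dK : ℝ) * CL * (64 * M ^ 2) ^ (|2 * z.re + 1| + 2 * min (min r₁ r₂) z.re + 1) * (32 * M ^ 2) ^ (|2 * z.re + 2| + 2 * min (min r₁ r₂) z.re) * max 1 lam)
    (fun i => norm_nonneg _) hF (fun i σ => norm_nonneg _) (fun i σ => ?_)).trans (le_of_eq ?_)
  · -- per place: ★ p864675 at `Y := σ(γ̂)·A_σ`, movers `κ_σ κ′_σ`, read back on the frame point, then repacked
    obtain ⟨Fv, j₀, hj₀, hf, hK, hlin, hint⟩ := harc i σ s hs₁
    have h675 := norm_corner_lineWhittaker_le_of_boundedMovers_kType ι hι hf (hχ1 σ) (hχ σ) hK hCL hlin hint hM (hPU σ) (hκκ' σ) (hκe σ) (hκ'e σ) (μf σ σf) j₀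
    rw [hj₀, ← hP σ, hμ σ] at h675
    exact perPlace_repack hdCL hB₁ hB₂ (Finset.sum_nonneg fun _ _ => sq_nonneg _) (norm_nonneg _) (apply_nonneg _ _) hlam hκ₁ hκ₂ h675
  · beta_reduce
    ring

end Summit.HodgeConjecture.HodgeConjecture.Cruxes.HLiu418.K2LiuKindOneLineBlockLetterOfRecordKType

end
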